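import Summits.ResolutionOfSingularities.ResolutionOfSingularities.Theorems.FrobeniusClosingSteerRunHygieneTwo
import Summits.ResolutionOfSingularities.ResolutionOfSingularities.Theorems.FrobeniusClosingSteerMaxGenDictionary
import Literature.AlgebraicGeometry.Resolution.RegularLocalRingsUFD
import HarnessLib

/-!
# Crux `Steer` (stmt-ResolutionOfSingularities-16345), chain W4.1, E-ROW row 9 (R3) `EvenResidueLettersHeavyTwoN`, brick F3 **(U)**:
# at a NORMAL stage the simple order `S[s]` contains EVERY square-radical element of `K` (uniqueness of the maximal order)

OURS (campaign `res-hironaka`, rung L ★L-G4, slot W4.1; seat res-L0-w41-stub-3 g8, res-L0-w41-plan-1 RULING 266 (e); route = res-L0-w41-idea-2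
`g13/R3-PROOF-MAP.md` eab63904c0a3ca30 §1 (U) «`mem_order_of_sq_mem`»; replaces the role of no printed item; NOT a statement of the manuscript under review
[claim: Hironaka2017, status: under-review]; AI-produced, weaker than expert review). Theses-free, definition-free.

SETTING (member-local; characteristic `2`): `K = Frac(k[A₀, t])`, `t² ∈ A₀ ⊆ S`, `S ⊆ K` a regular local subring (a UFD, Matsumura Thm. 20.3), `s` a generator
(`s² ∈ S`, `t ∈ S[s]`) which is CARRIER-FREE (`s² ≠ g₀² + π²·u₀` for every non-unit `π`: `NormalAt` read in `S`) and satisfies the local–global Frobenius congruence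
(N5) `¬ π ∣ b ∧ b²·s² = a² + π²·c ⇒ s² = g₀² + π²·u₀`. CLAIM: every `z ∈ K` with `z² ∈ S` lies in `S[s] = S ⊕ S·s`.
PROOF (map §1): `z = x/y`, `x, y ∈ k[A₀, t] = A₀ ⊕ A₀·t` ⇒ `d·z = a + b·t = a₁ + b₁·s` with `d = y² ∈ A₀ ∖ 0`; UFD descent on `d`: for a prime `π ∣ d`, squaring gives
`b₁²·s² = a₁² + π²·(d′²z²)`; `π ∤ b₁` would produce a carrier by (N5) — excluded; so `π ∣ b₁`, then `π ∣ a₁`, cancel `π`.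

* `MaxOrder.exists_add_mul_of_mem_adjoin` — `k[A₀, t] = A₀ + A₀·t` when `t² ∈ A₀`;
* `MaxOrder.mem_closure_insert_of_sq_mem` — **(U)**. [cite: Matsumura1987, Thm. 20.3] [folklore]
-/

noncomputable section

set_option linter.dupNamespace false

open IsLocalRing
open Literature.AlgebraicGeometry.Resolution
open Summit.ResolutionOfSingularities.ResolutionOfSingularities.Theorems.SwitchingDichotomy.MaxGenDictionary

namespace Summit.ResolutionOfSingularities.ResolutionOfSingularities.Theorems.SwitchingDichotomy.MaxOrder

variable {k K : Type} [Field k] [Field K] [Algebra k K]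

/-- `k[A₀, t] = A₀ + A₀·t` when `t² ∈ A₀` (any characteristic). [folklore] -/
theorem exists_add_mul_of_mem_adjoin (A₀ : Subalgebra k K) (t : K) (htp : t ^ 2 ∈ A₀) {u : K}
    (hu : u ∈ Algebra.adjoin k (insert t (A₀ : Set K))) : ∃ a ∈ A₀, ∃ b ∈ A₀, u = a + b * t := by
  induction hu using Algebra.adjoin_induction with
  | mem x hx =>
    rcases hx with rfl | hx
    · exact ⟨0, A₀.zero_mem, 1, A₀.one_mem, by ring⟩
    · exact ⟨x, hx, 0, A₀.zero_mem, by ring⟩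
  | algebraMap r => exact ⟨algebraMap k K r, A₀.algebraMap_mem r, 0, A₀.zero_mem, by ring⟩
  | add x y _ _ hx hy =>
    obtain ⟨a, ha, b, hb, rfl⟩ := hx
    obtain ⟨c, hc, d, hd, rfl⟩ := hy
    exact ⟨a + c, A₀.add_mem ha hc, b + d, A₀.add_mem hb hd, by ring⟩
  | mul x y _ _ hx hy =>
    obtain ⟨a, ha, b, hb, rfl⟩ := hx
    obtain ⟨c, hc, d, hd, rfl⟩ := hy
    refine ⟨a * c + b * d * t ^ 2, A₀.add_mem (A₀.mul_mem ha hc) (A₀.mul_mem (A₀.mul_mem hb hd) htp), a * d + b * c,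
      A₀.add_mem (A₀.mul_mem ha hd) (A₀.mul_mem hb hc), by ring⟩

/-- **(U) the maximal order is unique.** See the module docstring. [cite: Matsumura1987, Thm. 20.3] [folklore] -/
theorem mem_closure_insert_of_sq_mem [CharP K 2] (A₀ : Subalgebra k K) (t : K) (htp : t ^ 2 ∈ A₀)
    (hfr : IsFractionRing (Algebra.adjoin k (insert t (A₀ : Set K))) K)
    (S : Subring K) [IsRegularLocalRing S] (hA₀ : A₀.toSubring ≤ S) {s : K} (hs : s ^ 2 ∈ S)
    (hgen : t ∈ Subring.closure (insert s (S : Set K)))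
    (hN5 : ∀ π a b c : S, Prime π → ¬ π ∣ b → b ^ 2 * ⟨s ^ 2, hs⟩ = a ^ 2 + π ^ 2 * c →
      ∃ g₀ u₀ : S, (⟨s ^ 2, hs⟩ : S) = g₀ ^ 2 + π ^ 2 * u₀)
    (hnc : ∀ g₀ u₀ π : S, π ∈ maximalIdeal S → (⟨s ^ 2, hs⟩ : S) ≠ g₀ ^ 2 + π ^ 2 * u₀)
    {z : K} (hz : z ^ 2 ∈ S) : z ∈ Subring.closure (insert s (S : Set K)) := by
  classical
  haveI : IsDomain S := isDomain_of_isRegularLocalRing S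
  haveI : UniqueFactorizationMonoid S := Matsumura1987_20_3_holds S inferInstance
  -- ### `d·z = a₁ + b₁·s` with `d ≠ 0`
  obtain ⟨x, y, hy, hxy⟩ := IsFractionRing.div_surjective (A := Algebra.adjoin k (insert t (A₀ : Set K))) z
  have hy0 : (y : K) ≠ 0 := fun h => nonZeroDivisors.ne_zero hy (Subtype.ext h)
  have hxy' : (x : K) / y = z := hxy
  obtain ⟨a, ha, b, hb, hab⟩ := exists_add_mul_of_mem_adjoin A₀ t htp (Subalgebra.mul_mem _ x.2 y.2)
  have hd : (y : K) ^ 2 ∈ A₀ := RunHygiene.sq_mem_of_mem_adjoin A₀ t htp y.2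
  obtain ⟨α, hα, β, hβ, htαβ⟩ := (mem_closure_insert_iff_of_sq_mem S hs t).mp hgen
  have key : ∀ (d : S), (d : K) ≠ 0 → ∀ a₁ b₁ : S, (d : K) * z = a₁ + b₁ * s → z ∈ Subring.closure (insert s (S : Set K)) := by
    intro d
    induction d using UniqueFactorizationMonoid.induction_on_prime with
    | h₁ => intro h; exact absurd rfl h
    | h₂ d hd =>
      intro _ a₁ b₁ heq
      obtain ⟨dinv, hdinv⟩ := hd.exists_left_inv
      have hz : z = (dinv : K) * a₁ + (dinv : K) * b₁ * s := by
        have h1 : (dinv : K) * ((d : K) * z) = (dinv : K) * (a₁ + b₁ * s) := by rw [heq]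
        rw [← mul_assoc, ← Subring.coe_mul, hdinv, Subring.coe_one, one_mul] at h1
        rw [h1]; ring
      rw [hz]
      exact (mem_closure_insert_iff_of_sq_mem S hs _).mpr
        ⟨dinv * a₁, (dinv * a₁).2, dinv * b₁, (dinv * b₁).2, rfl⟩
    | h₃ d π hd0 hπ ih =>
      intro hπd a₁ b₁ heq
      have hπ0 : (π : K) ≠ 0 := fun h => hπ.ne_zero (Subtype.ext h)
      have hd0' : (d : K) ≠ 0 := fun h => hd0 (Subtype.ext h)
      -- square the relation: `b₁² s² = a₁² + π² (d² z²)`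
      set w : S := d ^ 2 * ⟨z ^ 2, hz⟩ with hw
      have hsq : b₁ ^ 2 * (⟨s ^ 2, hs⟩ : S) = a₁ ^ 2 + π ^ 2 * w := by
        apply Subtype.ext
        have h2 : (2 : K) = 0 := CharTwo.two_eq_zero
        have hK : ((π : K) * d * z) ^ 2 = ((a₁ : K) + b₁ * s) ^ 2 := by rw [← heq, Subring.coe_mul]
        push_cast [hw]
        linear_combination -hK - ((a₁ : K) ^ 2 + (a₁ : K) * (b₁ * s)) * h2
      by_cases hπb : π ∣ b₁
      · -- `π ∣ b₁`, hence `π ∣ a₁`; cancel `π`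
        obtain ⟨b', rfl⟩ := hπb
        have hπa : π ∣ a₁ ^ 2 := by
          have : a₁ ^ 2 = (π * b') ^ 2 * ⟨s ^ 2, hs⟩ - π ^ 2 * w := by rw [hsq]; ring
          rw [this]
          exact dvd_sub (dvd_mul_of_dvd_left (dvd_pow (dvd_mul_right π b') two_ne_zero) _)
            (dvd_mul_of_dvd_left (dvd_pow_self π two_ne_zero) _)
        obtain ⟨a', rfl⟩ := hπ.dvd_of_dvd_pow hπa
        refine ih hd0' a' b' ?_
        have h1 : (π : K) * ((d : K) * z) = (π : K) * (a' + b' * s) := by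
          have := heq; push_cast at this; linear_combination this
        exact mul_left_cancel₀ hπ0 h1
      · -- `π ∤ b₁`: (N5) produces a carrier, excluded by normality
        obtain ⟨g₀, u₀, hF⟩ := hN5 π a₁ b₁ w hπ hπb hsq
        exact absurd hF (hnc g₀ u₀ π ((IsLocalRing.mem_maximalIdeal π).mpr hπ.not_unit))
  -- apply with `d = y²`
  refine key ⟨(y : K) ^ 2, hA₀ hd⟩ (pow_ne_zero 2 hy0) ⟨a + b * α, S.add_mem (hA₀ ha) (S.mul_mem (hA₀ hb) hα)⟩
    ⟨b * β, S.mul_mem (hA₀ hb) hβ⟩ ?_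
  have hxz : (y : K) ^ 2 * z = (x : K) * y := by
    rw [← hxy']; field_simp
  show (y : K) ^ 2 * z = (a + b * α) + b * β * s
  rw [hxz, hab, htαβ]
  ring

end Summit.ResolutionOfSingularities.ResolutionOfSingularities.Theorems.SwitchingDichotomy.MaxOrder

end
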